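import Summits.Ventures.PercRepro.ProfileGapMonoThresholdWGeneric
import Summits.Ventures.PercRepro.ProfileGapMonoThresholdHardPred
import Summits.Ventures.PercRepro.ProfileGapMonoThresholdRowLink

/-!
# PercRepro — THE THRESHOLD FAMILY FROM THE RULE ON THE HARD CLASS «EVERY POINT IS A COLOOP OF A SMALL COCIRCUIT»
(p5, gen 25; `proofs/P5-GM1.md` §25(h); announced INBOX before typing)

With `delMonoT_of_wGenericQ` (`ProfileGapMonoThresholdWGeneric`) the generic case of the inner induction dispatches
every weakly `(q−1)`-generic non-loop point, so the assemblies of `ProfileGapMonoThresholdHardPred` go through with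
the rule restricted to the STILL SMALLER hard class `HardTW N q` — no loop, no parallel pair, no coloop, no weakly
`(q−1)`-generic point: every point `z` lies in a cocircuit `D` with `ρ(D ∖ z) ≤ q − 1` of which it is a coloop
(`z ∉ cl(D ∖ z)`; a series pair is the case `ρ(D ∖ z) = 1`).  `HardTW N q → HardTW N q → HardT N q`, so
`HardRuleTW α q t → HardRuleTW α q t`: the new rule is weaker again and gives the same conclusions; at co-rank
`3` the band case `(I_4)`, `(★_3)` at `u = 4` and `(GM)_3` at every coloop at `u = 4` from `HardRuleTW α 3 4`.
Also the corollary for `(GM)_q` at `u = q + 1`: **`gapMonoQ_succ_of_wGenericQ`** (every rank, no rank condition).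

* `HardTW` (class), `HardRuleTW` (conjecture def, NOT asserted), `hardTPred_of_hardTW`, `hardRuleTW_of_hardRuleTPred`,
  `thresholdIneq_of_hardRuleTW_aux`, **`thresholdIneq_of_hardRuleTW`**, `thresholdIneq_row_of_hardRuleTW`,
  **`profileIneqMinusQ_pred_of_hardRuleTW`**, `thresholdIneq_succ_of_hardRuleTW_aux`,
  **`thresholdIneq_succ_of_hardRuleTW`**, **`thresholdIneq_three_four_of_hardRuleTW`**, `starQ_three_four_of_ruleW`,
  **`gapMonoQ_coloop_three_four_of_ruleW`**, **`gapMonoQ_succ_of_wGenericQ`**.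
-/

open scoped Matroid

namespace PercRepro.Cogirth

open Finset ThmH Skew Shadow Profile

variable {α : Type} [DecidableEq α] {M : Matroid α} [M.Finite]

section HardW

/-- **The hard class at co-rank `q`, weak form**: no loop, no parallel pair, no coloop, no weakly `(q−1)`-generic
point (every point is a coloop of a cocircuit `D` through it with `ρ(D ∖ z) ≤ q − 1`). -/
def HardTW (N : Matroid α) [N.Finite] (q : ℕ) : Prop :=
  (∀ x ∈ gr N, rk N {x} = 1) ∧
  (∀ x ∈ gr N, ∀ y ∈ gr N, x ≠ y → rk N {x, y} ≠ 1) ∧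
  (∀ x ∈ gr N, rk N ((gr N).erase x) + 1 ≠ rk N (gr N)) ∧
  (∀ x ∈ gr N, ¬ WGenericQ N x (q - 1))

/-- **The rule on the weak hard class** (a CONJECTURE, NOT asserted): every matroid of the smaller hard class on
a nonempty ground set has a deletion-monotone point for `(q, t)`. -/
def HardRuleTW (α : Type) [DecidableEq α] (q t : ℕ) : Prop :=
  ∀ (N : Matroid α) [N.Finite], HardTW N q → (gr N).Nonempty → ∃ z ∈ gr N, DelMonoT N z q t

/-- The weak hard class lies in the smaller hard class. -/
theorem hardTPred_of_hardTW {N : Matroid α} [N.Finite] {q : ℕ} (h : HardTW N q) : HardTPred N q :=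
  ⟨h.1, h.2.1, h.2.2.1, fun x hx hg => h.2.2.2 x hx (wGenericQ_of_genericQ hg)⟩

/-- The rule on the smaller hard class gives the rule on the weak hard class. -/
theorem hardRuleTW_of_hardRuleTPred {q t : ℕ} (h : HardRuleTPred α q t) : HardRuleTW α q t :=
  fun N _ hN hne => h N (hardTPred_of_hardTW hN) hne

/-- The inner induction on `#E` at a fixed co-rank `q ≥ 2`, every `t ≥ q` at once, WITHOUT a row hypothesis, given
the family one co-rank down and the rule on the weak hard class: the generic case dispatches every
`(q−1)`-generic point by `delMonoT_of_genericQ_pred`. -/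
theorem thresholdIneq_of_hardRuleTW_aux {q : ℕ} (hq : 2 ≤ q)
    (hprev : ∀ (K : Matroid α) [K.Finite] (t' : ℕ), q - 1 ≤ t' → ThresholdIneq K (q - 1) t')
    (hrule : ∀ t', q ≤ t' → HardRuleTW α q t') (n : ℕ) :
    ∀ (N : Matroid α) [N.Finite], (gr N).card = n → ∀ t, q ≤ t → ThresholdIneq N q t := by
  induction n using Nat.strong_induction_on with
  | _ n ih =>
  intro N _ hN t hqt
  have ihdel : ∀ z ∈ gr N, ∀ t', q ≤ t' → ThresholdIneq (N ＼ ({z} : Set α)) q t' := by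
    intro z hz t' ht'
    have hlt : ((gr N).erase z).card < n := by rw [← hN]; exact card_erase_lt_of_mem hz
    exact ih _ hlt (N ＼ ({z} : Set α)) (by rw [gr_delete']) t' ht'
  have ihdel' : ∀ z ∈ gr N, ∀ t', q - 1 ≤ t' → ThresholdIneq (N ＼ ({z} : Set α)) q t' := by
    intro z hz t' ht'
    rcases Nat.lt_or_ge t' q with h | h
    · have : t' = q - 1 := by omega
      rw [this]
      exact (thresholdIneq_pred_iff (by omega)).2 (ihdel z hz q (le_refl q))
    · exact ihdel z hz t' h
  rcases (gr N).eq_empty_or_nonempty with hempty | hne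
  · exact thresholdIneq_of_card_eq_zero (by rw [hempty, card_empty])
  -- a loop
  by_cases hloop : ∃ ℓ ∈ gr N, rk N {ℓ} = 0
  · obtain ⟨ℓ, hℓ, h0⟩ := hloop
    exact thresholdIneq_of_loop hℓ h0 (ihdel ℓ hℓ t hqt)
  -- a parallel pair
  by_cases hpar : ∃ z ∈ gr N, ∃ z' ∈ gr N, z ≠ z' ∧ rk N {z, z'} = 1
  · obtain ⟨z, hz, z', hz', hzz', hpar⟩ := hpar
    have hz1 : rk N {z} = 1 := by
      have h1 := rk_mono' (M := N) (show ({z} : Finset α) ⊆ {z, z'} by simp)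
      have h2 : rk N {z} ≠ 0 := fun h => hloop ⟨z, hz, h⟩
      omega
    have hz'1 : rk N {z'} = 1 := by
      have h1 := rk_mono' (M := N) (show ({z'} : Finset α) ⊆ {z, z'} by simp)
      have h2 : rk N {z'} ≠ 0 := fun h => hloop ⟨z', hz', h⟩
      omega
    have hdm := delMonoT_of_parallel hz hz' hzz' hz1 hz'1 hpar hq (by omega)
      (hprev _ (t - 1) (by omega))
    exact thresholdIneq_of_delMonoT hdm (ihdel z hz t hqt)
  -- a coloop
  by_cases hcol : ∃ z ∈ gr N, rk N ((gr N).erase z) + 1 = rk N (gr N)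
  · obtain ⟨z, hz, hzc⟩ := hcol
    exact thresholdIneq_of_coloop hz hzc hq (by omega) (ihdel' z hz (t - 1) (by omega))
      (hprev _ t (by omega))
  -- a weakly `(q−1)`-generic point
  by_cases hgen : ∃ z ∈ gr N, WGenericQ N z (q - 1)
  · obtain ⟨z, hz, hg⟩ := hgen
    have hz1 : rk N {z} = 1 := by
      have h2 : rk N {z} ≠ 0 := fun h => hloop ⟨z, hz, h⟩
      have h3 : rk N {z} ≤ 1 := by
        have := rk_le_card (M := N) ({z} : Finset α)
        simpa using this
      omega
    have hzI : N.Indep {z} := by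
      have h := indep_of_rk_eq_card (M := N) (X := {z}) (by rw [card_singleton]; exact hz1)
      rwa [coe_singleton] at h
    have hdm := delMonoT_of_wGenericQ hzI hg hq (by omega) (hprev _ (t - 1) (by omega))
    exact thresholdIneq_of_delMonoT hdm (ihdel z hz t hqt)
  -- the weak hard class: the rule
  have hhard : HardTW N q := by
    refine ⟨?_, ?_, ?_, ?_⟩
    · intro x hx
      have h2 : rk N {x} ≠ 0 := fun h => hloop ⟨x, hx, h⟩
      have h3 : rk N {x} ≤ 1 := by
        have := rk_le_card (M := N) ({x} : Finset α)
        simpa using this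
      omega
    · intro x hx y hy hxy h
      exact hpar ⟨x, hx, y, hy, hxy, h⟩
    · intro x hx h
      exact hcol ⟨x, hx, h⟩
    · intro x hx h
      exact hgen ⟨x, hx, h⟩
  obtain ⟨z, hz, hdm⟩ := hrule t hqt N hhard hne
  exact thresholdIneq_of_delMonoT hdm (ihdel z hz t hqt)

/-- **The threshold family at every offset `≥ 0` from the rule on the weak hard class ALONE**: for `2 ≤ q ≤ t`,
`(I_t)` on every finite matroid, given `HardRuleTW α q' t'` for all `2 ≤ q' ≤ q`, `q' ≤ t'`. -/
theorem thresholdIneq_of_hardRuleTW (hrule : ∀ q' t', 2 ≤ q' → q' ≤ t' → HardRuleTW α q' t') :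
    ∀ q, 2 ≤ q → ∀ (N : Matroid α) [N.Finite], ∀ t, q ≤ t → ThresholdIneq N q t := by
  intro q
  induction q with
  | zero => intro h; omega
  | succ q ihq =>
    intro hq N _ t hqt
    have hprev : ∀ (K : Matroid α) [K.Finite] (t' : ℕ), q + 1 - 1 ≤ t' → ThresholdIneq K (q + 1 - 1) t' := by
      intro K _ t' ht'
      rw [Nat.add_sub_cancel] at ht' ⊢
      rcases Nat.lt_or_ge q 2 with h | h
      · have : q = 1 := by omega
        rw [this]; exact thresholdIneq_one K t'
      · exact ihq h K t' ht'
    exact thresholdIneq_of_hardRuleTW_aux hq hprev (fun t' ht' => hrule (q + 1) t' hq ht') _ N rfl t hqt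

/-- **The rows `(q−1, q)` of every co-rank `q ≥ 2` from the rule on the weak hard class alone** (threshold
form). -/
theorem thresholdIneq_row_of_hardRuleTW (hrule : ∀ q' t', 2 ≤ q' → q' ≤ t' → HardRuleTW α q' t')
    {q : ℕ} (hq : 2 ≤ q) (N : Matroid α) [N.Finite] : ThresholdIneq N q (q - 1) :=
  (thresholdIneq_pred_iff (by omega)).2 (thresholdIneq_of_hardRuleTW hrule q hq N q (le_refl q))

/-- **The rows `(q−1, q)` of the profile, every co-rank `q ≥ 2`, from the rule on the weak hard class alone.** -/
theorem profileIneqMinusQ_pred_of_hardRuleTW (hrule : ∀ q' t', 2 ≤ q' → q' ≤ t' → HardRuleTW α q' t')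
    {q : ℕ} (hq : 2 ≤ q) (N : Matroid α) [N.Finite] : ProfileIneqMinusQ N (q - 1) q :=
  (thresholdIneq_iff_row (by omega)).1 (thresholdIneq_row_of_hardRuleTW hrule hq N)

/-- The inner induction on `#E` for the single threshold `t = q + 1` (`2 ≤ q`) on the weak hard class: the family
one co-rank down, the row `(q−1, q)` in its offset-`0` form, and the rule `HardRuleTW α q (q+1)` only. -/
theorem thresholdIneq_succ_of_hardRuleTW_aux {q : ℕ} (hq : 2 ≤ q)
    (hprev : ∀ (K : Matroid α) [K.Finite] (t' : ℕ), q - 1 ≤ t' → ThresholdIneq K (q - 1) t')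
    (hrow : ∀ (K : Matroid α) [K.Finite], ThresholdIneq K q q)
    (hrule : HardRuleTW α q (q + 1)) (n : ℕ) :
    ∀ (N : Matroid α) [N.Finite], (gr N).card = n → ThresholdIneq N q (q + 1) := by
  induction n using Nat.strong_induction_on with
  | _ n ih =>
  intro N _ hN
  have ihdel : ∀ z ∈ gr N, ThresholdIneq (N ＼ ({z} : Set α)) q (q + 1) := by
    intro z hz
    have hlt : ((gr N).erase z).card < n := by rw [← hN]; exact card_erase_lt_of_mem hz
    exact ih _ hlt (N ＼ ({z} : Set α)) (by rw [gr_delete'])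
  rcases (gr N).eq_empty_or_nonempty with hempty | hne
  · exact thresholdIneq_of_card_eq_zero (by rw [hempty, card_empty])
  -- a loop
  by_cases hloop : ∃ ℓ ∈ gr N, rk N {ℓ} = 0
  · obtain ⟨ℓ, hℓ, h0⟩ := hloop
    exact thresholdIneq_of_loop hℓ h0 (ihdel ℓ hℓ)
  -- a parallel pair
  by_cases hpar : ∃ z ∈ gr N, ∃ z' ∈ gr N, z ≠ z' ∧ rk N {z, z'} = 1
  · obtain ⟨z, hz, z', hz', hzz', hpar⟩ := hpar
    have hz1 : rk N {z} = 1 := by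
      have h1 := rk_mono' (M := N) (show ({z} : Finset α) ⊆ {z, z'} by simp)
      have h2 : rk N {z} ≠ 0 := fun h => hloop ⟨z, hz, h⟩
      omega
    have hz'1 : rk N {z'} = 1 := by
      have h1 := rk_mono' (M := N) (show ({z'} : Finset α) ⊆ {z, z'} by simp)
      have h2 : rk N {z'} ≠ 0 := fun h => hloop ⟨z', hz', h⟩
      omega
    have hdm := delMonoT_of_parallel hz hz' hzz' hz1 hz'1 hpar hq (by omega)
      (hprev _ (q + 1 - 1) (by omega))
    exact thresholdIneq_of_delMonoT hdm (ihdel z hz)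
  -- a coloop
  by_cases hcol : ∃ z ∈ gr N, rk N ((gr N).erase z) + 1 = rk N (gr N)
  · obtain ⟨z, hz, hzc⟩ := hcol
    have h1 : ThresholdIneq (N ＼ ({z} : Set α)) q (q + 1 - 1) := by
      rw [Nat.add_sub_cancel]
      exact hrow _
    exact thresholdIneq_of_coloop hz hzc hq (by omega) h1 (hprev _ (q + 1) (by omega))
  -- a weakly `(q−1)`-generic point
  by_cases hgen : ∃ z ∈ gr N, WGenericQ N z (q - 1)
  · obtain ⟨z, hz, hg⟩ := hgen
    have hz1 : rk N {z} = 1 := by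
      have h2 : rk N {z} ≠ 0 := fun h => hloop ⟨z, hz, h⟩
      have h3 : rk N {z} ≤ 1 := by
        have := rk_le_card (M := N) ({z} : Finset α)
        simpa using this
      omega
    have hzI : N.Indep {z} := by
      have h := indep_of_rk_eq_card (M := N) (X := {z}) (by rw [card_singleton]; exact hz1)
      rwa [coe_singleton] at h
    have hdm := delMonoT_of_wGenericQ hzI hg hq (by omega) (hprev _ (q + 1 - 1) (by omega))
    exact thresholdIneq_of_delMonoT hdm (ihdel z hz)
  -- the weak hard class: the rule
  have hhard : HardTW N q := by
    refine ⟨?_, ?_, ?_, ?_⟩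
    · intro x hx
      have h2 : rk N {x} ≠ 0 := fun h => hloop ⟨x, hx, h⟩
      have h3 : rk N {x} ≤ 1 := by
        have := rk_le_card (M := N) ({x} : Finset α)
        simpa using this
      omega
    · intro x hx y hy hxy h
      exact hpar ⟨x, hx, y, hy, hxy, h⟩
    · intro x hx h
      exact hcol ⟨x, hx, h⟩
    · intro x hx h
      exact hgen ⟨x, hx, h⟩
  obtain ⟨z, hz, hdm⟩ := hrule N hhard hne
  exact thresholdIneq_of_delMonoT hdm (ihdel z hz)

/-- **The band case `(I_{q+1})` from the single rule instance `(q, q+1)` on the weak hard class** (`2 ≤ q`),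
given the family one co-rank down and the row `(q−1, q)` in its offset-`0` form. -/
theorem thresholdIneq_succ_of_hardRuleTW {q : ℕ} (hq : 2 ≤ q)
    (hprev : ∀ (K : Matroid α) [K.Finite] (t' : ℕ), q - 1 ≤ t' → ThresholdIneq K (q - 1) t')
    (hrow : ∀ (K : Matroid α) [K.Finite], ThresholdIneq K q q)
    (hrule : HardRuleTW α q (q + 1)) (N : Matroid α) [N.Finite] : ThresholdIneq N q (q + 1) :=
  thresholdIneq_succ_of_hardRuleTW_aux hq hprev hrow hrule _ N rfl

/-- **`(I_4)` at co-rank `3` from the single rule instance `HardRuleTW α 3 4`** — the rule on the simple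
coloop-free matroids in which every point lies in a cocircuit `D` with `ρ(D ∖ z) ≤ 2` (co-rank `2` and the row
`(2, 3)` are theorems). -/
theorem thresholdIneq_three_four_of_hardRuleTW (hrule : HardRuleTW α 3 4) (N : Matroid α) [N.Finite] :
    ThresholdIneq N 3 4 :=
  thresholdIneq_succ_of_hardRuleTW (q := 3) (by norm_num)
    (fun K _ t' ht' => thresholdIneq_two K (by omega)) (fun K _ => thresholdIneq_three_three K) hrule N

/-- **`(★_3)` at `u = 4` from the single rule instance `HardRuleTW α 3 4`.** -/
theorem starQ_three_four_of_ruleW {z : α} (hrule : HardRuleTW α 3 4) : StarQ M z 3 4 :=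
  (starQ_succ_iff_thresholdIneq (by norm_num)).2 (thresholdIneq_three_four_of_hardRuleTW hrule _)

/-- **`(GM)_3` at every coloop at the level `u = 4` from the single rule instance `HardRuleTW α 3 4`** — the
first hard instance of the coloop band case, now from the rule on the weak hard class. -/
theorem gapMonoQ_coloop_three_four_of_ruleW {z : α} (hz : z ∈ gr M)
    (hzc : rk M ((gr M).erase z) + 1 = rk M (gr M)) (hrule : HardRuleTW α 3 4) : GapMonoQ M z 3 4 := by
  have hrow : ProfileIneqMinusQ (M ＼ ({z} : Set α)) 3 (3 + 1 - 1) := by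
    rw [Nat.add_sub_cancel]
    exact profileIneqMinusQ_self _ 3
  exact gapMonoQ_of_coloop_of_starQ hz hzc (by norm_num) (by norm_num) hrow (starQ_three_four_of_ruleW hrule)

/-- **`(GM)_q` at the level `u = q + 1` at every weakly `q`-generic non-loop point, every rank** (`1 ≤ q`), from the
row `(q−1, q)` of `N ／ z`. -/
theorem gapMonoQ_succ_of_wGenericQ {N : Matroid α} [N.Finite] {z : α} {q : ℕ} (hzI : N.Indep {z})
    (hw : WGenericQ N z q) (hq : 1 ≤ q) (hdel : ProfileIneqMinusQ (N ／ ({z} : Set α)) (q - 1) q) :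
    GapMonoQ N z q (q + 1) := by
  have hrow : ThresholdIneq (N ／ ({z} : Set α)) q q :=
    (thresholdIneq_pred_iff hq).1 ((thresholdIneq_iff_row hq).2 hdel)
  have hw' : WGenericQ N z (q + 1 - 1) := by
    rw [Nat.add_sub_cancel]; exact hw
  have hrow' : ThresholdIneq (N ／ ({z} : Set α)) (q + 1 - 1) (q + 1 - 1) := by
    rw [Nat.add_sub_cancel]; exact hrow
  have hdm : DelMonoT N z (q + 1) (q + 1) :=
    delMonoT_of_wGenericQ hzI hw' (by omega) (by omega) hrow'
  have h := (delMonoT_self_iff_gapMonoQ (by omega : 1 ≤ q + 1)).1 hdm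
  rwa [Nat.add_sub_cancel] at h

end HardW

end PercRepro.Cogirth
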